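import Mathlib.LinearAlgebra.Matrix.Transvection
import Mathlib.LinearAlgebra.Matrix.SchurComplement
import Mathlib.Data.Matrix.ColumnRowPartitioned
import Mathlib.Logic.Equiv.Fintype
import HarnessLib

/-!
# A `2s × 2s` normal form for determinants with `s` variable entries (Hrubeš–Joglekar 2025, Lemma 1)

Hrubeš–Joglekar, *On read-k projections of the determinant* (STACS 2025), Lemma 1: a square
matrix `M` of any size over `𝔽 ∪ X` with `s ≥ 1` entries containing a variable has the same
determinant as a `2s × 2s` matrix `H` over `𝔽 ∪ X` with the same variable occurrences, all on
the main diagonal. It is the step of the counting argument (their Thms. 2 and 7) that bounds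
the number of PARAMETERS of such determinants by a function of `s` alone.

We prove it as a determinant identity over an arbitrary commutative `F`-algebra `R'` (the
"variables" are arbitrary elements `w_q ∈ R'`, the "constants" come from `F`):

* `exists_det_eq_const_mul_det_normalForm`: for a constant matrix `C₀` (any finite index type)
  and positions `pos q` (`q < s`), `det (C₀ + ∑_q w_q E_{pos q}) = c · det (diag(w, 0) + H)` for
  some `c ∈ F` and `H ∈ F^{2s × 2s}`. (Print absorbs `c` into a constant column of `H`; we keep it
  as a factor, which is all the counting needs.)

## Proof

Step 1 of the printed proof borders the matrix once per variable entry. We use instead ONE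
block identity (`exists_normalForm_rankUpdate`): with `U`, `W` the `0/1` incidence matrices of
the rows and columns of the positions, `∑_q w_q E_{pos q} = U diag(w) W`, and the Schur
complement of the invertible block `K = (diag w, 1; 1, 0)` in
`B = (C₀, (0 U); (0; W), K)` gives `det B = det K · det (C₀ + U diag(w) W)` with
`det K = det (0, 1; 1, 0)` a non-zero constant (Mathlib's `Matrix.det_fromBlocks₂₂`). In `B` the
`w_q` are diagonal entries and everything else is constant.

Step 2 (`exists_normalForm_core`, for `diag(w_1..w_s, 0..0) + C` on `Fin s ⊕ τ`; the general
index type is reduced to this in `exists_normalForm_of_embedding`): diagonalise the constant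
`τ × τ` block by determinant-one matrices (Mathlib's transvection decomposition
`Matrix.Pivot.exists_list_transvec_mul_mul_list_transvec_eq_diagonal`), acting block-diagonally
so that `diag(w, 0)` is untouched; clear the constant rows/columns through the non-zero pivots by
block-unipotent matrices (again fixing `diag(w, 0)`, `conj_diagonal_add_map`); rescale the pivots
to `1` (the factor `c`); now the rows and columns of the non-zero pivots are unit vectors and
drop out of the determinant (`Matrix.det_eq_det_submatrix_of_offBlock`); if more than `s` zero
pivots remain the determinant vanishes (`Matrix.det_fromBlocks_zero₂₂_of_card_lt`, a zero block
with too many columns), otherwise the remaining rows/columns embed into a second copy of `Fin s`,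
padded by unit vectors. This is the rank argument of the printed Step 2 ("`B` has `s` rows, it
has rank at most `s` … `D₂` has rank at most `m`") made explicit.

## References

* P. Hrubeš, P. S. Joglekar, *On read-k projections of the determinant*, STACS 2025, LIPIcs 327,
  Art. 53, doi:10.4230/LIPIcs.STACS.2025.53: Lemma 1 and its proof (p. 53:3).
-/

open Matrix

namespace Matrix

variable {n : Type*} [Fintype n] [DecidableEq n] {R : Type*} [CommRing R]

/-- **Unit block removal.** If a square matrix agrees with the identity matrix in every entry
having a row or a column index outside the block `p`, its determinant is the determinant of the
block `p`. [folklore] -/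
theorem det_eq_det_submatrix_of_offBlock (M : Matrix n n R) (p : n → Prop) [DecidablePred p]
    (h : ∀ i j, (¬ p i ∨ ¬ p j) → M i j = if i = j then 1 else 0) :
    M.det = (M.submatrix (Subtype.val : {i // p i} → n) Subtype.val).det := by
  rw [← det_submatrix_equiv_self (Equiv.sumCompl p) M]
  have : M.submatrix (Equiv.sumCompl p) (Equiv.sumCompl p) =
      fromBlocks (M.submatrix Subtype.val Subtype.val) 0 0 1 := by
    ext (i | i) (j | j)
    · rfl
    · simp only [submatrix_apply, Equiv.sumCompl_apply_inl, Equiv.sumCompl_apply_inr,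
        fromBlocks_apply₁₂, zero_apply]
      rw [h _ _ (Or.inr j.2), if_neg]
      exact fun hij => j.2 (hij ▸ i.2)
    · simp only [submatrix_apply, Equiv.sumCompl_apply_inl, Equiv.sumCompl_apply_inr,
        fromBlocks_apply₂₁, zero_apply]
      rw [h _ _ (Or.inl i.2), if_neg]
      exact fun hij => i.2 (hij ▸ j.2)
    · simp only [submatrix_apply, Equiv.sumCompl_apply_inr, fromBlocks_apply₂₂]
      rw [h _ _ (Or.inl i.2), one_apply]
      by_cases hij : i = j
      · subst hij; simp
      · rw [if_neg (fun h' => hij (Subtype.ext h')), if_neg hij]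
  rw [this, det_fromBlocks_zero₂₁, det_one, mul_one]

/-- **Zero block.** A block matrix `(A B; C 0)` whose zero block has more columns than `A` has
rows is singular (every term of the Leibniz expansion uses an entry of the zero block: the
columns of the second block cannot all be sent to rows of the first). [folklore] -/
theorem det_fromBlocks_zero₂₂_of_card_lt {m k : Type*} [Fintype m] [DecidableEq m] [Fintype k]
    [DecidableEq k] (A : Matrix m m R) (B : Matrix m k R) (C : Matrix k m R)
    (h : Fintype.card m < Fintype.card k) : (fromBlocks A B C 0).det = 0 := by
  rw [det_apply]
  refine Finset.sum_eq_zero fun σ _ => ?_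
  -- some column of the second block is sent to a row of the second block
  obtain ⟨j, hj⟩ : ∃ j : k, ∃ j' : k, σ (Sum.inr j) = Sum.inr j' := by
    by_contra hne
    push Not at hne
    have hinl : ∀ j : k, ∃ i : m, σ (Sum.inr j) = Sum.inl i := fun j => by
      rcases hσ : σ (Sum.inr j) with i | j'
      · exact ⟨i, rfl⟩
      · exact absurd hσ (hne j j')
    choose f hf using hinl
    have hinj : Function.Injective f := fun j₁ j₂ h12 => by
      have := (hf j₁).trans ((congrArg Sum.inl h12).trans (hf j₂).symm)
      simpa using σ.injective this
    exact absurd (Fintype.card_le_of_injective f hinj) (not_le.2 h)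
  obtain ⟨j', hj'⟩ := hj
  rw [Finset.prod_eq_zero (Finset.mem_univ (Sum.inr j)) (by rw [hj']; rfl), smul_zero]

/-- **Diagonalisation by determinant-one matrices** (packaging Mathlib's
`Matrix.Pivot.exists_list_transvec_mul_mul_list_transvec_eq_diagonal`: transvections have
determinant `1`). [folklore] -/
theorem exists_det_one_mul_mul_eq_diagonal {𝕜 : Type*} [Field 𝕜] (D : Matrix n n 𝕜) :
    ∃ (G G' : Matrix n n 𝕜) (δ : n → 𝕜), G.det = 1 ∧ G'.det = 1 ∧ G * D * G' = diagonal δ := by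
  obtain ⟨L, L', δ, h⟩ := Pivot.exists_list_transvec_mul_mul_list_transvec_eq_diagonal D
  exact ⟨_, _, δ, TransvectionStruct.det_toMatrix_prod L, TransvectionStruct.det_toMatrix_prod L', h⟩

end Matrix

namespace Literature.LinearAlgebra.Matrix

open _root_.Matrix

variable {F : Type*} [Field F] {R' : Type*} [CommRing R'] [Algebra F R']

section Core

variable {s : ℕ} {τ : Type*} [Fintype τ] [DecidableEq τ]

/-- Conjugating `diag(w, 0) + C` by block matrices whose first diagonal block is the identity
and which are block upper resp. lower triangular does not touch the variable part `diag(w, 0)`.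
[folklore] -/
theorem conj_diagonal_add_map (w : Fin s → R') (C : Matrix (Fin s ⊕ τ) (Fin s ⊕ τ) F)
    (X : Matrix (Fin s) τ F) (S : Matrix τ τ F) (Y : Matrix τ (Fin s) F) (S' : Matrix τ τ F) :
    (fromBlocks 1 X 0 S).map (algebraMap F R') * (diagonal (Sum.elim w 0) + C.map (algebraMap F R')) *
        (fromBlocks 1 0 Y S').map (algebraMap F R') =
      diagonal (Sum.elim w 0) +
        (fromBlocks 1 X 0 S * C * fromBlocks 1 0 Y S').map (algebraMap F R') := by
  rw [Matrix.mul_add, Matrix.add_mul, Matrix.map_mul, Matrix.map_mul]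
  congr 1
  have hDg : diagonal (Sum.elim w (0 : τ → R')) = fromBlocks (diagonal w) 0 0 (0 : Matrix τ τ R') := by
    ext (i | i) (j | j) <;> simp [diagonal_apply]
  rw [hDg, fromBlocks_map, fromBlocks_map]
  simp [fromBlocks_multiply, Matrix.map_one, Matrix.map_zero]

/-- **The core reduction** (Hrubeš–Joglekar 2025, Lemma 1, second step, in the form used here):
for a matrix `diag(w_1, …, w_s, 0, …, 0) + C` with `C` constant (entries in the field `F`,
the `w_q` in an `F`-algebra `R'`), there are `c ∈ F` and a constant `2s × 2s` matrix `H` with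
`det (diag(w, 0) + C) = c · det (diag(w, 0) + H)`. Proof: diagonalise the constant lower-right
block by determinant-one matrices, clear the rows and columns through its non-zero pivots,
normalise the pivots to `1` (this costs the factor `c`), drop these unit rows/columns, and
re-embed the remaining (at most `s`, else the determinant vanishes) rows/columns into a second
copy of `Fin s`. [cite: HrubesJoglekar2025, Lemma 1 (p. 53:3)] -/
theorem exists_normalForm_core (w : Fin s → R') (C : Matrix (Fin s ⊕ τ) (Fin s ⊕ τ) F) :
    ∃ (c : F) (H : Matrix (Fin s ⊕ Fin s) (Fin s ⊕ Fin s) F),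
      (diagonal (Sum.elim w 0) + C.map (algebraMap F R')).det =
        algebraMap F R' c * (diagonal (Sum.elim w 0) + H.map (algebraMap F R')).det := by
  classical
  set φ : F →+* R' := algebraMap F R' with hφ
  -- the blocks of `C`
  set P := C.toBlocks₁₁ with hP
  set Q := C.toBlocks₁₂ with hQ
  set Rm := C.toBlocks₂₁ with hRm
  set D := C.toBlocks₂₂ with hDdef
  have hC : C = fromBlocks P Q Rm D := (fromBlocks_toBlocks C).symm
  -- (i) diagonalise `D` by determinant-one matrices
  obtain ⟨G, G', δ, hG, hG', hD⟩ := exists_det_one_mul_mul_eq_diagonal D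
  -- indicators of the zero / non-zero pivots, and the pivot scaling
  set ind₀ : τ → F := fun t => if δ t = 0 then 1 else 0 with hind₀
  set ind₁ : τ → F := fun t => if δ t = 0 then 0 else 1 with hind₁
  set sci : τ → F := fun t => if δ t = 0 then 1 else (δ t)⁻¹ with hsci
  set sc : τ → F := fun t => if δ t = 0 then 1 else δ t with hsc
  have hδ : ∀ t, (δ t)⁻¹ * δ t = 1 - ind₀ t := fun t => by
    simp only [hind₀]; split_ifs with h
    · simp [h]
    · rw [inv_mul_cancel₀ h, sub_zero]
  have hδ' : ∀ t, δ t * (δ t)⁻¹ = 1 - ind₀ t := fun t => by rw [mul_comm, hδ]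
  have hsci_ind₀ : ∀ t, sci t * ind₀ t = ind₀ t := fun t => by
    simp only [hsci, hind₀]; split_ifs <;> simp
  have hsci_δ : ∀ t, sci t * δ t = ind₁ t := fun t => by
    simp only [hsci, hind₁]; split_ifs with h
    · simp [h]
    · exact inv_mul_cancel₀ h
  have hsc_sci : ∀ t, sc t * sci t = 1 := fun t => by
    simp only [hsc, hsci]; split_ifs with h
    · simp
    · exact mul_inv_cancel₀ h
  -- (ii)–(iv) the transformation matrices (constant, over `F`)
  set X : Matrix (Fin s) τ F := -(Q * G' * diagonal fun t => (δ t)⁻¹) with hX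
  set Y : Matrix τ (Fin s) F := -((diagonal fun t => (δ t)⁻¹) * (G * Rm)) with hY
  set TL : Matrix (Fin s ⊕ τ) (Fin s ⊕ τ) F := fromBlocks 1 (X * G) 0 (diagonal sci * G) with hTL
  set TR : Matrix (Fin s ⊕ τ) (Fin s ⊕ τ) F := fromBlocks 1 0 (G' * Y) G' with hTR
  set Q₃ : Matrix (Fin s) τ F := Q * G' * diagonal ind₀ with hQ₃
  set R₃ : Matrix τ (Fin s) F := diagonal ind₀ * (G * Rm) with hR₃
  have hTCT : ∃ P₃ : Matrix (Fin s) (Fin s) F,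
      TL * C * TR = fromBlocks P₃ Q₃ R₃ (diagonal ind₁) := by
    refine ⟨((1 : Matrix (Fin s) (Fin s) F) * P + X * G * Rm) * (1 : Matrix (Fin s) (Fin s) F) +
      ((1 : Matrix (Fin s) (Fin s) F) * Q + X * G * D) * (G' * Y), ?_⟩
    rw [hC, hTL, hTR, fromBlocks_multiply, fromBlocks_multiply]
    have hD_r : ∀ Z : Matrix τ (Fin s) F, G * (D * (G' * Z)) = diagonal δ * Z := fun Z => by
      rw [← Matrix.mul_assoc, ← Matrix.mul_assoc, hD]
    have hD_r' : G * (D * G') = diagonal δ := by rw [← Matrix.mul_assoc, hD]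
    have hdiag₁ : (diagonal fun t => (δ t)⁻¹) * diagonal δ = 1 - diagonal ind₀ := by
      ext i j
      rw [diagonal_mul_diagonal, Matrix.sub_apply, diagonal_apply, Matrix.one_apply,
        diagonal_apply]
      by_cases h : i = j
      · subst h; simp [hδ]
      · simp [h]
    have hdiag₂ : diagonal δ * (diagonal fun t => (δ t)⁻¹) = 1 - diagonal ind₀ := by
      ext i j
      rw [diagonal_mul_diagonal, Matrix.sub_apply, diagonal_apply, Matrix.one_apply,
        diagonal_apply]
      by_cases h : i = j
      · subst h; simp [hδ']
      · simp [h]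
    have hdiag₃ : diagonal sci * diagonal ind₀ = diagonal ind₀ := by
      rw [diagonal_mul_diagonal]; congr 1; funext t; exact hsci_ind₀ t
    have hdiag₄ : diagonal sci * diagonal δ = diagonal ind₁ := by
      rw [diagonal_mul_diagonal]; congr 1; funext t; exact hsci_δ t
    congr 1
    · -- block `₁₂`: `Q G' + X G D G' = Q G' diag(ind₀)`
      simp only [Matrix.mul_zero, zero_add, Matrix.one_mul, Matrix.add_mul, Matrix.mul_assoc,
        hD_r']
      rw [hX, Matrix.neg_mul, Matrix.mul_assoc, Matrix.mul_assoc, hdiag₁, Matrix.mul_sub,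
        Matrix.mul_one, Matrix.mul_sub, hQ₃, Matrix.mul_assoc]
      abel
    · -- block `₂₁`: `sci G Rm + sci G D G' Y = diag(ind₀) G Rm`
      simp only [Matrix.zero_mul, zero_add, Matrix.mul_one, Matrix.mul_assoc, hD_r]
      rw [← Matrix.mul_add, hY, Matrix.mul_neg, ← Matrix.mul_assoc (diagonal δ), hdiag₂,
        Matrix.sub_mul, Matrix.one_mul]
      have : G * Rm + -(G * Rm - diagonal ind₀ * (G * Rm)) = diagonal ind₀ * (G * Rm) := by abel
      rw [this, ← Matrix.mul_assoc, hdiag₃, hR₃]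
    · -- block `₂₂`: `sci G D G' = diag(ind₁)`
      simp only [Matrix.zero_mul, zero_add, Matrix.mul_zero, Matrix.mul_assoc, hD_r', hdiag₄]
  obtain ⟨P₃, hP₃⟩ := hTCT
  -- determinants of the transformations
  have hdetTL : TL.det = ∏ t, sci t := by
    rw [hTL, det_fromBlocks_zero₂₁, det_one, one_mul, det_mul, hG, mul_one, det_diagonal]
  have hdetTR : TR.det = 1 := by
    rw [hTR, det_fromBlocks_zero₁₂, det_one, one_mul, hG']
  -- the reduced matrix
  set C₃ := fromBlocks P₃ Q₃ R₃ (diagonal ind₁) with hC₃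
  set M := diagonal (Sum.elim w 0) + C.map φ with hM
  set M₆ := diagonal (Sum.elim w 0) + C₃.map φ with hM₆
  have hconj : TL.map φ * M * TR.map φ = M₆ := by
    rw [hM, hM₆, hTL, hTR, hφ, conj_diagonal_add_map, ← hTL, ← hTR, hP₃]
  have hmapdet : ∀ T : Matrix (Fin s ⊕ τ) (Fin s ⊕ τ) F, (T.map φ).det = φ T.det := fun T => by
    rw [RingHom.map_det, RingHom.mapMatrix_apply]
  have hdetM : M.det = φ (∏ t, sc t) * M₆.det := by
    have h1 : M₆.det = φ (∏ t, sci t) * M.det := by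
      rw [← hconj, det_mul, det_mul, hmapdet, hmapdet, hdetTL, hdetTR, map_one, mul_one]
    rw [h1, ← mul_assoc, ← map_mul, ← Finset.prod_mul_distrib,
      Finset.prod_eq_one (fun t _ => hsc_sci t), map_one, one_mul]
  -- (v) the rows and columns of the non-zero pivots are unit vectors: drop them
  set p : Fin s ⊕ τ → Prop := fun x => Sum.elim (fun _ => True) (fun t => δ t = 0) x with hp
  have hM₆_entry : ∀ i j, M₆ i j = diagonal (Sum.elim w 0) i j + φ (C₃ i j) := fun i j => rfl
  have hunit : ∀ i j, (¬ p i ∨ ¬ p j) → M₆ i j = if i = j then 1 else 0 := by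
    rintro (q | t) (q' | t') h
    · simp [hp] at h
    · -- column `inr t'` with `δ t' ≠ 0`
      have ht' : δ t' ≠ 0 := by simpa [hp] using h
      rw [hM₆_entry, hC₃, fromBlocks_apply₁₂, hQ₃, mul_diagonal, if_neg (by simp)]
      simp [hind₀, ht']
    · have ht : δ t ≠ 0 := by simpa [hp] using h
      rw [hM₆_entry, hC₃, fromBlocks_apply₂₁, hR₃, diagonal_mul, if_neg (by simp)]
      simp [hind₀, ht]
    · have htt : δ t ≠ 0 ∨ δ t' ≠ 0 := by simpa [hp] using h
      rw [hM₆_entry, hC₃, fromBlocks_apply₂₂, diagonal_apply, diagonal_apply]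
      by_cases e : t = t'
      · subst e
        have ht : δ t ≠ 0 := htt.elim id id
        simp [hind₁, ht]
      · rw [if_neg (by simpa using e), if_neg e, if_neg (by simpa using e), map_zero, add_zero]
  have hdrop := M₆.det_eq_det_submatrix_of_offBlock p hunit
  -- the remaining block, indexed by `Fin s ⊕ {t // δ t = 0}`
  set T₀ := {t : τ // δ t = 0}
  let eA : Fin s ⊕ T₀ → {x : Fin s ⊕ τ // p x} := fun x =>
    match x with
    | Sum.inl q => ⟨Sum.inl q, trivial⟩
    | Sum.inr t => ⟨Sum.inr t.1, t.2⟩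
  have heA : Function.Bijective eA := by
    constructor
    · rintro (q | t) (q' | t') h <;> simp only [eA, Subtype.mk.injEq, Sum.inl.injEq,
        Sum.inr.injEq, reduceCtorEq] at h
      · rw [h]
      · rw [Subtype.ext h]
    · rintro ⟨q | t, hx⟩
      · exact ⟨Sum.inl q, rfl⟩
      · exact ⟨Sum.inr ⟨t, hx⟩, rfl⟩
  set EA := Equiv.ofBijective eA heA with hEA
  -- its explicit form
  set K : Matrix (Fin s ⊕ T₀) (Fin s ⊕ T₀) R' := fromBlocks (diagonal w + P₃.map φ)
    (Matrix.of fun q t => φ (Q₃ q t.1)) (Matrix.of fun t q => φ (R₃ t.1 q)) 0 with hK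
  have hKA : (M₆.submatrix (Subtype.val : {x // p x} → _) Subtype.val).submatrix EA EA = K := by
    ext (q | t) (q' | t')
    · simp only [submatrix_apply, hEA, Equiv.ofBijective_apply, eA, hK, fromBlocks_apply₁₁,
        hM₆_entry, hC₃, Matrix.add_apply, map_apply, diagonal_apply, Sum.inl.injEq, Sum.elim_inl]
    · simp only [submatrix_apply, hEA, Equiv.ofBijective_apply, eA, hK, fromBlocks_apply₁₂,
        hM₆_entry, hC₃, of_apply, diagonal_apply, reduceCtorEq, if_false, zero_add]
    · simp only [submatrix_apply, hEA, Equiv.ofBijective_apply, eA, hK, fromBlocks_apply₂₁,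
        hM₆_entry, hC₃, of_apply, diagonal_apply, reduceCtorEq, if_false, zero_add]
    · simp only [submatrix_apply, hEA, Equiv.ofBijective_apply, eA, hK, fromBlocks_apply₂₂,
        hM₆_entry, hC₃, Matrix.zero_apply, diagonal_apply, Sum.inr.injEq, Sum.elim_inr,
        Pi.zero_apply]
      by_cases e : t.1 = t'.1
      · rw [if_pos e, if_pos e, zero_add]
        have : ind₁ t.1 = 0 := by simp [hind₁, t.2]
        rw [this, map_zero]
      · rw [if_neg e, if_neg e, map_zero, add_zero]
  have hdetM₆ : M₆.det = K.det := by
    rw [hdrop, ← hKA, det_submatrix_equiv_self]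
  -- (vi) too many zero pivots: the determinant vanishes
  by_cases hcard : s < Fintype.card T₀
  · refine ⟨0, 0, ?_⟩
    rw [map_zero, zero_mul, hdetM, hdetM₆, hK,
      det_fromBlocks_zero₂₂_of_card_lt _ _ _ (by simpa using hcard), mul_zero]
  -- (vii) otherwise re-embed the zero pivots into a second copy of `Fin s`
  push Not at hcard
  obtain ⟨j⟩ := Function.Embedding.nonempty_of_card_le (α := T₀) (β := Fin s) (by simpa using hcard)
  classical
  set QH : Matrix (Fin s) (Fin s) F := Matrix.of fun q q' => ∑ t : T₀, if j t = q' then Q₃ q t.1 else 0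
    with hQH
  set RH : Matrix (Fin s) (Fin s) F := Matrix.of fun q' q => ∑ t : T₀, if j t = q' then R₃ t.1 q else 0
    with hRH
  set EH : Matrix (Fin s) (Fin s) F := diagonal fun q' => if ∃ t, j t = q' then 0 else 1 with hEH
  set H := fromBlocks P₃ QH RH EH with hH
  refine ⟨∏ t, sc t, H, ?_⟩
  rw [hdetM]
  congr 1
  -- `det M₆ = det K = det (diag(w,0) + H)`
  set MH : Matrix (Fin s ⊕ Fin s) (Fin s ⊕ Fin s) R' := diagonal (Sum.elim w 0) + H.map φ with hMH
  have hMH_entry : ∀ i j, MH i j = diagonal (Sum.elim w 0) i j + φ (H i j) := fun i j => rfl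
  set pB : Fin s ⊕ Fin s → Prop := fun y => Sum.elim (fun _ => True) (fun q' => ∃ t, j t = q') y
    with hpB
  have hsum_of_not : ∀ q', (¬ ∃ t, j t = q') → ∀ (f : T₀ → F),
      (∑ t : T₀, if j t = q' then f t else 0) = 0 := fun q' hq' f =>
    Finset.sum_eq_zero fun t _ => if_neg fun h => hq' ⟨t, h⟩
  have hsum_j : ∀ (t : T₀) (f : T₀ → F), (∑ t' : T₀, if j t' = j t then f t' else 0) = f t := by
    intro t f
    rw [Finset.sum_eq_single t (fun t' _ ht' => if_neg fun h => ht' (j.injective h))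
      (fun h => absurd (Finset.mem_univ t) h), if_pos rfl]
  have hunitH : ∀ i j', (¬ pB i ∨ ¬ pB j') → MH i j' = if i = j' then 1 else 0 := by
    rintro (q | q₁) (q' | q₂) h
    · simp [hpB] at h
    · have hq₂ : ¬ ∃ t, j t = q₂ := by simpa [hpB] using h
      rw [hMH_entry, hH, fromBlocks_apply₁₂, hQH, of_apply, hsum_of_not q₂ hq₂, map_zero,
        diagonal_apply, if_neg (by simp), if_neg (by simp), add_zero]
    · have hq₁ : ¬ ∃ t, j t = q₁ := by simpa [hpB] using h
      rw [hMH_entry, hH, fromBlocks_apply₂₁, hRH, of_apply, hsum_of_not q₁ hq₁, map_zero,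
        diagonal_apply, if_neg (by simp), if_neg (by simp), add_zero]
    · have hq : (¬ ∃ t, j t = q₁) ∨ ¬ ∃ t, j t = q₂ := by simpa [hpB] using h
      rw [hMH_entry, hH, fromBlocks_apply₂₂, hEH, diagonal_apply, diagonal_apply]
      by_cases e : q₁ = q₂
      · subst e
        have hq₁ : ¬ ∃ t, j t = q₁ := hq.elim id id
        simp [hq₁]
      · rw [if_neg (by simpa using e), if_neg e, if_neg (by simpa using e), map_zero, add_zero]
  have hdropH := MH.det_eq_det_submatrix_of_offBlock pB hunitH
  let eB : Fin s ⊕ T₀ → {y : Fin s ⊕ Fin s // pB y} := fun x =>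
    match x with
    | Sum.inl q => ⟨Sum.inl q, trivial⟩
    | Sum.inr t => ⟨Sum.inr (j t), ⟨t, rfl⟩⟩
  have heB : Function.Bijective eB := by
    constructor
    · rintro (q | t) (q' | t') h <;> simp only [eB, Subtype.mk.injEq, Sum.inl.injEq,
        Sum.inr.injEq, reduceCtorEq] at h
      · rw [h]
      · rw [j.injective h]
    · rintro ⟨q | q', hy⟩
      · exact ⟨Sum.inl q, rfl⟩
      · obtain ⟨t, rfl⟩ : ∃ t, j t = q' := hy
        exact ⟨Sum.inr t, rfl⟩
  set EB := Equiv.ofBijective eB heB with hEB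
  have hKB : (MH.submatrix (Subtype.val : {y // pB y} → _) Subtype.val).submatrix EB EB = K := by
    ext (q | t) (q' | t')
    · simp only [submatrix_apply, hEB, Equiv.ofBijective_apply, eB, hK, fromBlocks_apply₁₁,
        hMH_entry, hH, Matrix.add_apply, map_apply, diagonal_apply, Sum.inl.injEq, Sum.elim_inl]
    · simp only [submatrix_apply, hEB, Equiv.ofBijective_apply, eB, hK, fromBlocks_apply₁₂,
        hMH_entry, hH, of_apply, diagonal_apply, reduceCtorEq, if_false, zero_add, hQH, hsum_j]
    · simp only [submatrix_apply, hEB, Equiv.ofBijective_apply, eB, hK, fromBlocks_apply₂₁,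
        hMH_entry, hH, of_apply, diagonal_apply, reduceCtorEq, if_false, zero_add, hRH, hsum_j]
    · simp only [submatrix_apply, hEB, Equiv.ofBijective_apply, eB, hK, fromBlocks_apply₂₂,
        hMH_entry, hH, Matrix.zero_apply, diagonal_apply, Sum.inr.injEq, Sum.elim_inr, hEH,
        Pi.zero_apply]
      by_cases e : t = t'
      · subst e
        rw [if_pos rfl, if_pos rfl, if_pos ⟨t, rfl⟩, zero_add, map_zero]
      · rw [if_neg (fun h => e (j.injective h)), if_neg (fun h => e (j.injective h)), map_zero,
          add_zero]
  rw [hdetM₆, hdropH, ← hKB, det_submatrix_equiv_self]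

end Core

section General

variable {s : ℕ}

/-- The core reduction for an arbitrary finite index type: the variable entries `w_q` sit on the
diagonal at the positions of an embedding `a : Fin s ↪ J`, all other entries are constant.
[cite: HrubesJoglekar2025, Lemma 1 (p. 53:3)] -/
theorem exists_normalForm_of_embedding {J : Type*} [Fintype J] [DecidableEq J] (a : Fin s ↪ J)
    (w : Fin s → R') (d : J → R') (hd₁ : ∀ q, d (a q) = w q)
    (hd₂ : ∀ x, (∀ q, a q ≠ x) → d x = 0) (Cc : Matrix J J F) :
    ∃ (c : F) (H : Matrix (Fin s ⊕ Fin s) (Fin s ⊕ Fin s) F),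
      (diagonal d + Cc.map (algebraMap F R')).det =
        algebraMap F R' c * (diagonal (Sum.elim w 0) + H.map (algebraMap F R')).det := by
  classical
  -- reindex `J ≃ Fin s ⊕ {x // x ∉ range a}`
  let e : Fin s ⊕ {x // ¬ x ∈ Set.range a} ≃ J :=
    (Equiv.sumCongr (Equiv.ofInjective a a.injective) (Equiv.refl _)).trans
      (Equiv.sumCompl (· ∈ Set.range a))
  have he_inl : ∀ q, e (Sum.inl q) = a q := fun q => by
    simp [e, Equiv.sumCompl_apply_inl]
  have he_inr : ∀ x : {x // ¬ x ∈ Set.range a}, e (Sum.inr x) = x.1 := fun x => by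
    simp [e, Equiv.sumCompl_apply_inr]
  have hde : d ∘ e = Sum.elim w 0 := by
    funext x
    rcases x with q | x
    · rw [Function.comp_apply, he_inl, hd₁, Sum.elim_inl]
    · rw [Function.comp_apply, he_inr, Sum.elim_inr, Pi.zero_apply]
      exact hd₂ _ fun q h => x.2 ⟨q, h⟩
  obtain ⟨c, H, hcH⟩ := exists_normalForm_core (R' := R') w (Cc.submatrix e e)
  refine ⟨c, H, ?_⟩
  have hsub : (diagonal d + Cc.map (algebraMap F R')).submatrix e e =
      diagonal (Sum.elim w 0) + (Cc.submatrix e e).map (algebraMap F R') := by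
    rw [← hde, ← submatrix_diagonal_equiv]; rfl
  rw [← hcH, ← det_submatrix_equiv_self e, hsub]

/-- **Normal form for a diagonal rank-`s` update** (Hrubeš–Joglekar 2025, Lemma 1, both steps):
`det (C₀ + U · diag(w) · W) = c · det (diag(w, 0) + H)` for some `c ∈ F` and a constant
`2s × 2s` matrix `H`. The first step of the printed proof (one bordering per variable entry)
is replaced by the single block identity
`det (C₀, (0 U); (0; W), (diag w, 1; 1, 0)) = det (diag w, 1; 1, 0) · det (C₀ + U diag(w) W)`
(Schur complement of the invertible block `(diag w, 1; 1, 0)`, whose determinant is the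
constant `det (0, 1; 1, 0)`), after which `exists_normalForm_of_embedding` applies to the big
matrix, in which the `w_q` are diagonal entries. [cite: HrubesJoglekar2025, Lemma 1 (p. 53:3)] -/
theorem exists_normalForm_rankUpdate {m : Type*} [Fintype m] [DecidableEq m]
    (C₀ : Matrix m m F) (U : Matrix m (Fin s) F) (W : Matrix (Fin s) m F) (w : Fin s → R') :
    ∃ (c : F) (H : Matrix (Fin s ⊕ Fin s) (Fin s ⊕ Fin s) F),
      (C₀.map (algebraMap F R') + U.map (algebraMap F R') * diagonal w * W.map (algebraMap F R')).det =
        algebraMap F R' c * (diagonal (Sum.elim w 0) + H.map (algebraMap F R')).det := by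
  classical
  set φ : F →+* R' := algebraMap F R' with hφ
  -- the big matrix and its Schur complement
  set K : Matrix (Fin s ⊕ Fin s) (Fin s ⊕ Fin s) R' := fromBlocks (diagonal w) 1 1 0 with hK
  set Kinv : Matrix (Fin s ⊕ Fin s) (Fin s ⊕ Fin s) R' := fromBlocks 0 1 1 (-diagonal w) with hKinv
  have hKKinv : K * Kinv = 1 := by
    rw [hK, hKinv, fromBlocks_multiply]; simp [fromBlocks_one]
  letI : Invertible K := invertibleOfRightInverse K Kinv hKKinv
  have hinvK : ⅟K = Kinv := invOf_eq_right_inv hKKinv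
  set B : Matrix (m ⊕ (Fin s ⊕ Fin s)) (m ⊕ (Fin s ⊕ Fin s)) R' :=
    fromBlocks (C₀.map φ) (fromCols 0 (U.map φ)) (fromRows 0 (W.map φ)) K with hB
  have hdetB : B.det = K.det * (C₀.map φ + U.map φ * diagonal w * W.map φ).det := by
    rw [hB, det_fromBlocks₂₂, hinvK, hKinv, fromCols_mul_fromBlocks, fromCols_mul_fromRows]
    congr 2
    simp only [zero_add, Matrix.mul_one, Matrix.mul_zero, Matrix.mul_neg,
      Matrix.neg_mul, sub_neg_eq_add]
  -- `det K` is a non-zero constant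
  set JF : Matrix (Fin s ⊕ Fin s) (Fin s ⊕ Fin s) F := fromBlocks 0 1 1 0 with hJF
  have hKfac : K = (fromBlocks 1 (diagonal w) 0 1) * JF.map φ := by
    rw [hK, hJF, fromBlocks_map, fromBlocks_multiply]
    simp [Matrix.map_one, Matrix.map_zero]
  have hdetK : K.det = φ JF.det := by
    rw [hKfac, det_mul, det_fromBlocks_zero₂₁, det_one, one_mul, one_mul, RingHom.map_det,
      RingHom.mapMatrix_apply]
  have hJF2 : JF * JF = 1 := by
    rw [hJF, fromBlocks_multiply]; simp [fromBlocks_one]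
  have hdetJF : JF.det ≠ 0 := fun h => by
    have := congrArg Matrix.det hJF2
    rw [det_mul, det_one, h, zero_mul] at this
    exact zero_ne_one this
  -- `B` is `diag(d) + constant` with the `w_q` on the diagonal at `inr (inl q)`
  let a : Fin s ↪ m ⊕ (Fin s ⊕ Fin s) := ⟨fun q => Sum.inr (Sum.inl q), fun q q' h => by
    simpa using h⟩
  set d : m ⊕ (Fin s ⊕ Fin s) → R' := fun x => Sum.elim (fun _ => 0) (Sum.elim w fun _ => 0) x
    with hd
  set Cbig : Matrix (m ⊕ (Fin s ⊕ Fin s)) (m ⊕ (Fin s ⊕ Fin s)) F :=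
    fromBlocks C₀ (fromCols 0 U) (fromRows 0 W) (fromBlocks 0 1 1 0) with hCbig
  have hBeq : B = diagonal d + Cbig.map φ := by
    rw [hB, hCbig, hK, fromBlocks_map, fromBlocks_map, fromCols_map, fromRows_map]
    have hdiag : diagonal d = fromBlocks 0 0 0 (fromBlocks (diagonal w) 0 0 0) := by
      ext (i | (q | q)) (i' | (q' | q')) <;> simp [hd, diagonal_apply]
    rw [hdiag, fromBlocks_add, fromBlocks_add]
    simp [Matrix.map_zero, Matrix.map_one]
  obtain ⟨c, H, hcH⟩ := exists_normalForm_of_embedding (R' := R') a w d (fun q => rfl)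
    (fun x hx => by
      rcases x with i | (q | q)
      · rfl
      · exact absurd rfl (hx q)
      · rfl) Cbig
  refine ⟨JF.det⁻¹ * c, H, ?_⟩
  have h1 : φ JF.det * (C₀.map φ + U.map φ * diagonal w * W.map φ).det =
      φ c * (diagonal (Sum.elim w 0) + H.map φ).det := by
    rw [← hdetK, ← hdetB, hBeq, hcH]
  have h2 : φ JF.det⁻¹ * (φ JF.det * (C₀.map φ + U.map φ * diagonal w * W.map φ).det) =
      (C₀.map φ + U.map φ * diagonal w * W.map φ).det := by
    rw [← mul_assoc, ← map_mul, inv_mul_cancel₀ hdetJF, map_one, one_mul]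
  rw [← h2, h1, ← mul_assoc, ← map_mul]

/-- **Hrubeš–Joglekar 2025, Lemma 1, as a determinant identity.** Let `N` be a square matrix
over an `F`-algebra `R'` which is constant (`C₀`) except that the element `w_q ∈ R'` is added
at the position `pos q` (`q < s`; positions may repeat). Then
`det N = c · det (diag(w_1, …, w_s, 0, …, 0) + H)` for some `c ∈ F` and a constant
`2s × 2s` matrix `H`: a determinant with `s` variable entries is, up to a constant factor, the
determinant of a `2s × 2s` matrix with the same variable entries on its diagonal and constants
elsewhere (in print: "there exists a `2s × 2s` matrix `H` of variable size `s` … such that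
`det(H) = det(M)`; moreover each variable occurs in `H` the same number of times as in `M` and
the variables appear on the main diagonal of `H` only" — the constant `c` is absorbed into a
column of `H` there; we keep it separate). [cite: HrubesJoglekar2025, Lemma 1 (p. 53:3)] -/
theorem exists_det_eq_const_mul_det_normalForm {m : Type*} [Fintype m] [DecidableEq m]
    (C₀ : Matrix m m F) (pos : Fin s → m × m) (w : Fin s → R') :
    ∃ (c : F) (H : Matrix (Fin s ⊕ Fin s) (Fin s ⊕ Fin s) F),
      (C₀.map (algebraMap F R') + ∑ q, w q • Matrix.single (pos q).1 (pos q).2 (1 : R')).det =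
        algebraMap F R' c * (diagonal (Sum.elim w 0) + H.map (algebraMap F R')).det := by
  classical
  set U : Matrix m (Fin s) F := Matrix.of fun i q => if (pos q).1 = i then 1 else 0 with hU
  set W : Matrix (Fin s) m F := Matrix.of fun q j => if (pos q).2 = j then 1 else 0 with hW
  have hN : C₀.map (algebraMap F R') + ∑ q, w q • Matrix.single (pos q).1 (pos q).2 (1 : R') =
      C₀.map (algebraMap F R') + U.map (algebraMap F R') * diagonal w * W.map (algebraMap F R') := by
    congr 1
    ext i j
    rw [Matrix.sum_apply, Matrix.mul_apply]
    refine Finset.sum_congr rfl fun q _ => ?_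
    rw [mul_diagonal, Matrix.smul_apply, Matrix.single_apply, map_apply, map_apply, hU, hW, of_apply,
      of_apply, smul_eq_mul]
    by_cases h1 : (pos q).1 = i <;> by_cases h2 : (pos q).2 = j <;> simp [h1, h2]
  rw [hN]
  exact exists_normalForm_rankUpdate C₀ U W w

end General

end Literature.LinearAlgebra.Matrix
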